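import Summits.QuantumFields.BalabanUV.T4Continuum.Support.ClusterRepOfDomains
import Literature.MathematicalPhysics.QuantumFieldTheory.Dimock2011to13.UrsellConnectedGraphSum
import Literature.MathematicalPhysics.QuantumFieldTheory.Balaban1983to89.T4InputCauchyRateTermwise

/-!
# NE5 ∕ U3, crux O1 of `SKELETON-NE5-P1`, row O1-d part d1 — the TERM LABELS of the (2.13)∘(2.9)∘Σ_{𝐃,P}(2.14) expansion of
# [Balaban1988RG2Cluster] §2 as the index type of `T4InputCauchyRateTermwise.TermRep` (types, finite catalogues, `ρᵀ`, bookkeeping)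

Cell `pub-balaban`, unit `b2b-balaban-t4-ne5-formalise-leaf-02` (NE5 formalisation swarm, leaf prover 02; row O1-d1 of the owner's
`O1-CLAIM-TABLE-NE5-P1.md` v1.2, journal l.5367).  Summits-side NEW WORK under the LEAN PLACEMENT RULE (cell modelling + kernel-checked
bookkeeping; the manuscripts under audit are cited for KIND∕locus only, nothing printed there is asserted).  HONEST FRAMING: rung (B)+1
bookkeeping for the FINITE-VOLUME T⁴ programme — NOT the continuum limit by itself, NOT infinite volume, NOT a mass gap, NOT Clay; NE5
is NOT PROVED (NOT PRINTED, cell GAPS G-t4-U3-1); spine 0∕9.  HONEST DEPENDENCY (cell line, verbatim): continuum YM on T⁴ ⇐ BetaPertH ∧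
nine spine estimates (0/9 proved); BetaPertH ⇐ (D1) ∧ (D4) ∧ CAP+tail; G-an2-4 gates asym, D1 and NE2/3/4.

ROW O1-d (owner's table; `B13StepDesign.md` v0.2 §3): the output functional `Out k` of the `StepModel` instance for [II] §2 is to be
delivered through `TermRep M K T W` — at every class point `HasSum (fun i => T k i o h X) (Out k o h X)` over ONE index type for all
steps and domains (irrelevant terms are zero).  d1 (this file) = the index type and its finite combinatorics; d2 = the terms; d3 =
`TermRep` on the class.  PRINTED KIND ([II] = [Balaban1988RG2Cluster], PDF page = journal page; loci sheet `t4/b2b-balaban-t4-ne5-p1/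
b13-loci.md` v1.5): p. 14 *"(2.1) = Σ_Z H(Z), where H(Z) = Σ_{Z₀: Z̃₀⊂Z} H(Z, Z₀). (2.9)"*, *"E^{(k+1)}(X) = Σ_{n=1}^∞ (1/n!) Σ_{(Z₁,…,Zₙ):
∪Zᵢ = X} ρᵀ(Z₁,…,Zₙ)H(Z₁)…H(Zₙ), (2.13) where X ∈ 𝐃_{k+1}"*, (2.12) *"ρᵀ(Z) = 1, and ρᵀ(Z₁,…,Zₙ) = Σ_{g∈Cₙ} Π_{{i,j}∈g} (ζ(Zᵢ, Zⱼ) − 1),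
Cₙ is the set of connected graphs on the set {1,…,n}"*, (2.11) *"ζ(Z, Z′) = 0 if Z ∩ Z′ contains a cube, or a wall of a cube"*, and
*"The activities H(Z) are sums of many terms, more exactly the sums in (2.9), (2.1), (2.3) over Z₀, 𝐃, P."*; p. 12 the Mayer
subfamilies *"𝐃 ⊂ 𝐃_k"* (2.1), the bond sets `P` (2.3), *"the smallest localization domain Z₀∈𝐃_k containing Y₀ and P … bonds of P have
to be contained in the interior of Z₀"*; p. 15 *"Y ⊂ Z₀, and Z̃₀ ⊂ Z ⊂ X"*; p. 20 Lemma 3 *"for a localization domain Z∈𝐃_{k+1}"*.  So ONE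
term of the fully expanded output at `X` is an ORDERED tuple of `n ≥ 1` factors, the `i`-th being one resummed term (2.14) of `H(Zᵢ)`,
labelled `(Zᵢ; Z₀, 𝐃, P)`; the parameters `s, σ, t, τ` and the Gaussian fields are integration variables INSIDE a term, not labels.

DELIVERED (generic over `C : T4OutputRate.Carriers`, route P2's landed footprint geometry `ClusterRepOfDomains.DomainGeometry` — BY NAME,
one geometry for both routes — and the extra DATA `InnerData`; NO estimate): §1 `InnerLabel`∕`PolyLabel`∕**`TermIdx D Bnd := Σ n, Fin (n+1)
→ PolyLabel D Bnd`**; §2 `InnerData`, the decidable predicates `InnerLabel.WF`∕`PolyLabel.WF`∕`Covers`∕`TermIdx.LocalizesAt k X` and the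
FINITE catalogues `innerLabels`∕`polyLabels`∕`polyTuples`∕`termLabels` with membership lemmas (`mem_termLabels`: for every `(k, X, n)` only
finitely many labels localize at `X`); §3 `rhoT` = (2.12)'s `ρᵀ` for the geometry's touching relation AS the tree's Möbius-defined
`LatticeModels.hcUrsell`, `rhoT_eq_sum_graphs` (the printed connected-graph formula, via the tree's reproduction
`Dimock2011to13.UrsellConnectedGraphSum.hcUrsell_eq_sum_graphs`), `rhoT_one`, `rhoT_perm`, `coeff = ρᵀ/(n+1)!`; §4
`sum_termLabels_eq_sum_polyTuples` (flat term family ↔ (2.13)∘(2.9) at level `n`: product of sums = sum over tuples of inner labels) and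
`hasSum_of_levelwise` (absolute convergence by levels ⟹ `HasSum` on `TermIdx`); §5 DESIGN FINDING: `TermBound`∕`TermBudget` weigh terms
by `a k i` NOT seeing `X`, so ABSOLUTE labels make `Σ_i a k i ≤ G` extensive in the number of domains of the step volume (∝ `L^{4(K−k)}`),
whereas (2.41) p. 21 is a bound PER `X`; a volume-uniform `G` needs labels CODED RELATIVE TO `X` (translation-covariantly; O1-a's torus
supplies it).  Tool: `Coding` (per-`(k, X)` injective codes), `Coding.lift`, `Coding.hasSum_lift_iff`, **`Coding.termRep_lift`** (`TermRep`
transfers along any coding, BY NAME), `Coding.absolute` (non-vacuity).  0 sorry; axioms ⊆ {propext, Classical.choice, Quot.sound}.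
NOT HERE: the terms (d2, after O1-b∕O1-c fix `Op`∕`Hist`), `Out := Σ'`∕`TermRep` (d3), the geometry instance (O1-a supplies
`DomainGeometry` + `InnerData`), the finer printed constraints on `(Z₀, P)` (d2 zeroes unused labels), every estimate (O2–O6).
-/

namespace Summit.QuantumFields.BalabanUV.T4Continuum.B13StepTermLabels

open scoped BigOperators
open Literature.MathematicalPhysics.QuantumFieldTheory.Balaban1983to89.T4OutputRate (Carriers)
open Literature.MathematicalPhysics.QuantumFieldTheory.Balaban1983to89.T4InputCauchyRateData (StepModel)
open Literature.MathematicalPhysics.QuantumFieldTheory.Balaban1983to89.T4InputCauchyRateTermwise (TermRep)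
open Literature.Probability.LatticeModels (hcUrsell hcUrsell_singleton hcUrsell_map)
open Literature.MathematicalPhysics.QuantumFieldTheory.Dimock2011to13.UrsellConnectedGraphSum
  (pairs zetaSubOne Adj hcUrsell_eq_sum_graphs)
open Literature.MathematicalPhysics.QuantumFieldTheory.Dimock2011to13.MayerExpansion (IsConnColl)
open Summit.QuantumFields.BalabanUV.T4Continuum.ClusterRepOfDomains (DomainGeometry)

/-! ## §1 The labels -/

/-- [folklore] The INNER label of one resummed term (2.14) of an activity `H(Z)` ([II] p. 14: *"the sums in (2.9), (2.1), (2.3)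
over Z₀, 𝐃, P"*): the conditioning domain `Z₀ ∈ 𝐃_k` of (2.3)–(2.4), the Mayer subfamily `𝐃 ⊂ 𝐃_k` of (2.1) (`fam`; its union is
`Y₀`, (2.2)), the large-field bond set `P` of (2.3).  Plain data over a domain type `D` and a bond type `Bnd`. -/
structure InnerLabel (D Bnd : Type*) where
  Z₀ : D
  fam : Finset D
  P : Finset Bnd
  deriving DecidableEq

/-- [folklore] The label of ONE FACTOR of a term of (2.13): a polymer `Z` (drawn from the catalogue of the output domain, p. 20
Lemma 3 *"for a localization domain Z∈𝐃_{k+1}"*) together with the inner label of one term of `H(Z)`. -/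
structure PolyLabel (D Bnd : Type*) where
  Z : D
  inner : InnerLabel D Bnd
  deriving DecidableEq

/-- [folklore] **THE TERM INDEX** of the fully expanded one-step output (2.13)∘(2.9)∘Σ_{𝐃,P}(2.14): an ordered tuple of `n + 1`
factor labels, `n : ℕ` (the printed `n ≥ 1` is our `n + 1`; the coefficient is `ρᵀ/(n+1)!`).  ONE type for all steps and
domains, as `T4InputCauchyRateTermwise.TermRep` wants. -/
abbrev TermIdx (D Bnd : Type*) := Σ n : ℕ, (Fin (n + 1) → PolyLabel D Bnd)

/-- [folklore] The tuple of polymers `(Z₁,…,Zₙ)` of a term label. -/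
def TermIdx.polys {D Bnd : Type*} (t : TermIdx D Bnd) : Fin (t.1 + 1) → D := fun i => (t.2 i).Z

/-! ## §2 The extra geometric DATA, well-formedness, and the finite catalogues -/

section Catalogues

variable {C : Carriers} [DecidableEq C.Dom] {Cube : Type*} [DecidableEq Cube] {Bnd : Type*} [DecidableEq Bnd]

/-- [folklore] DATA beyond route P2's `DomainGeometry` that the labels of [II] §2 refer to (SUPPLIED by the carriers instance O1-a;
no property assumed): `innerLevel k` = the finite catalogue 𝐃_k of [II] feeding the step whose OUTPUT domains are the carriers'
`level k` (where `𝐕_k(Y, ·)`, `Y ∈ 𝐃_k`, and `Z₀ ∈ 𝐃_k` live); `bondsIn Z₀` = the unit-lattice bonds in the interior of `Z₀` (p. 12);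
`within Y Z` = "`Y` lies inside `Z`" across adjacent levels (p. 15 *"Y ⊂ Z₀, and Z̃₀ ⊂ Z ⊂ X"*). -/
structure InnerData (C : Carriers) (Bnd : Type*) where
  innerLevel : ℕ → Finset C.Dom
  bondsIn : C.Dom → Finset Bnd
  within : C.Dom → C.Dom → Prop
  [decWithin : DecidableRel within]

/-- [folklore] The cross-level inclusion is decidable (field `decWithin`). -/
instance InnerData.instDecWithin (D : InnerData C Bnd) : DecidableRel D.within := D.decWithin

/-- [folklore] The `InnerData` whose inclusion is FOOTPRINT inclusion in a `DomainGeometry` (the natural choice when all levels'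
footprints live in one cube type). -/
def InnerData.ofFootprints (G : DomainGeometry C Cube) (innerLevel : ℕ → Finset C.Dom) (bondsIn : C.Dom → Finset Bnd) :
    InnerData C Bnd where
  innerLevel := innerLevel
  bondsIn := bondsIn
  within Y Z := G.cubes Y ⊆ G.cubes Z

variable (G : DomainGeometry C Cube) (D : InnerData C Bnd)

/-- [folklore] WELL-FORMEDNESS of an inner label `(Z₀, 𝐃, P)` at step `k` under the polymer `Z`: `Z₀ ∈ 𝐃_k`, `𝐃 ⊆ 𝐃_k` with every
`Y ∈ 𝐃` inside `Z₀`, `P ⊆` the interior bonds of `Z₀`, and `Z₀` inside `Z` (pp. 12, 15).  The finer printed constraints (minimality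
of `Z₀`, `P` outside `Y₀` and off the tree bonds) are left to the term definition (zero terms). -/
def InnerLabel.WF (k : ℕ) (Z : C.Dom) (ℓ : InnerLabel C.Dom Bnd) : Prop :=
  ℓ.Z₀ ∈ D.innerLevel k ∧ ℓ.fam ⊆ D.innerLevel k ∧ (∀ Y ∈ ℓ.fam, D.within Y ℓ.Z₀) ∧ ℓ.P ⊆ D.bondsIn ℓ.Z₀ ∧ D.within ℓ.Z₀ Z

/-- [folklore] Well-formedness of an inner label is decidable. -/
instance InnerLabel.decWF (k : ℕ) (Z : C.Dom) (ℓ : InnerLabel C.Dom Bnd) : Decidable (ℓ.WF D k Z) := by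
  unfold InnerLabel.WF; infer_instance

/-- [folklore] The FINITE CATALOGUE of well-formed inner labels at step `k` under the polymer `Z`. -/
def innerLabels (k : ℕ) (Z : C.Dom) : Finset (InnerLabel C.Dom Bnd) :=
  (((D.innerLevel k).sigma fun Z₀ => (D.innerLevel k).powerset ×ˢ (D.bondsIn Z₀).powerset).image
      fun p => (⟨p.1, p.2.1, p.2.2⟩ : InnerLabel C.Dom Bnd)).filter fun ℓ => ℓ.WF D k Z

/-- [folklore] Membership in the inner catalogue IS well-formedness. -/
theorem mem_innerLabels {k : ℕ} {Z : C.Dom} {ℓ : InnerLabel C.Dom Bnd} : ℓ ∈ innerLabels D k Z ↔ ℓ.WF D k Z := by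
  refine ⟨fun h => (Finset.mem_filter.1 h).2, fun h => Finset.mem_filter.2 ⟨?_, h⟩⟩
  obtain ⟨h0, h1, -, h3, -⟩ := h
  refine Finset.mem_image.2 ⟨⟨ℓ.Z₀, (ℓ.fam, ℓ.P)⟩, ?_, rfl⟩
  exact Finset.mem_sigma.2 ⟨h0, Finset.mem_product.2 ⟨Finset.mem_powerset.2 h1, Finset.mem_powerset.2 h3⟩⟩

/-- [folklore] WELL-FORMEDNESS of a factor label `(Z; Z₀, 𝐃, P)` at step `k` for the output domain `X`: `Z` in the output
catalogue `level k` with footprint inside that of `X` (a member of a tuple covering `X`), and its inner label well formed. -/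
def PolyLabel.WF (k : ℕ) (X : C.Dom) (p : PolyLabel C.Dom Bnd) : Prop :=
  p.Z ∈ G.level k ∧ G.cubes p.Z ⊆ G.cubes X ∧ p.inner.WF D k p.Z

/-- [folklore] Well-formedness of a factor label is decidable. -/
instance PolyLabel.decWF (k : ℕ) (X : C.Dom) (p : PolyLabel C.Dom Bnd) : Decidable (p.WF G D k X) := by
  unfold PolyLabel.WF; infer_instance

/-- [folklore] The FINITE CATALOGUE of well-formed factor labels at `(k, X)`. -/
def polyLabels (k : ℕ) (X : C.Dom) : Finset (PolyLabel C.Dom Bnd) :=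
  ((((G.level k).filter fun Z => G.cubes Z ⊆ G.cubes X).sigma fun Z => innerLabels D k Z).image
    fun p => (⟨p.1, p.2⟩ : PolyLabel C.Dom Bnd))

/-- [folklore] Membership in the factor catalogue IS well-formedness. -/
theorem mem_polyLabels {k : ℕ} {X : C.Dom} {p : PolyLabel C.Dom Bnd} : p ∈ polyLabels G D k X ↔ p.WF G D k X := by
  constructor
  · intro h
    obtain ⟨q, hq, rfl⟩ := Finset.mem_image.1 h
    obtain ⟨hZ, hℓ⟩ := Finset.mem_sigma.1 hq
    obtain ⟨hZk, hZX⟩ := Finset.mem_filter.1 hZ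
    exact ⟨hZk, hZX, (mem_innerLabels D).1 hℓ⟩
  · rintro ⟨hZk, hZX, hℓ⟩
    refine Finset.mem_image.2 ⟨⟨p.Z, p.inner⟩, ?_, rfl⟩
    exact Finset.mem_sigma.2 ⟨Finset.mem_filter.2 ⟨hZk, hZX⟩, (mem_innerLabels D).2 hℓ⟩

/-- [folklore] The printed constraint *"∪Zᵢ = X"* of (2.13): the footprints of the tuple cover the footprint of `X` exactly. -/
def Covers (X : C.Dom) {n : ℕ} (Z : Fin (n + 1) → C.Dom) : Prop :=
  (Finset.univ.biUnion fun i => G.cubes (Z i)) = G.cubes X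

/-- [folklore] Covering is decidable. -/
instance decCovers (X : C.Dom) {n : ℕ} (Z : Fin (n + 1) → C.Dom) : Decidable (Covers G X Z) := by
  unfold Covers; infer_instance

/-- [folklore] The FINITE CATALOGUE of `(n+1)`-tuples of output-level polymers inside `X` covering `X` ((2.13)'s inner sum at
fixed `n`, before the activities are expanded). -/
def polyTuples (k : ℕ) (X : C.Dom) (n : ℕ) : Finset (Fin (n + 1) → C.Dom) :=
  (Fintype.piFinset fun _ => (G.level k).filter fun Z => G.cubes Z ⊆ G.cubes X).filter fun Z => Covers G X Z

/-- [folklore] Membership in the tuple catalogue. -/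
theorem mem_polyTuples {k : ℕ} {X : C.Dom} {n : ℕ} {Z : Fin (n + 1) → C.Dom} :
    Z ∈ polyTuples G k X n ↔ (∀ i, Z i ∈ G.level k ∧ G.cubes (Z i) ⊆ G.cubes X) ∧ Covers G X Z := by
  simp only [polyTuples, Finset.mem_filter, Fintype.mem_piFinset]

/-- [folklore] **A term label LOCALIZES AT `X` at step `k`**: every factor is well formed for `(k, X)` and the polymers cover `X`.
Off this set the term family of d2 is zero (`TermRep`'s convention). -/
def TermIdx.LocalizesAt (k : ℕ) (X : C.Dom) (t : TermIdx C.Dom Bnd) : Prop :=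
  (∀ i, (t.2 i).WF G D k X) ∧ Covers G X t.polys

/-- [folklore] Localization is decidable. -/
instance TermIdx.decLocalizesAt (k : ℕ) (X : C.Dom) (t : TermIdx C.Dom Bnd) : Decidable (t.LocalizesAt G D k X) := by
  unfold TermIdx.LocalizesAt; infer_instance

/-- [folklore] The FINITE CATALOGUE of term labels with `n + 1` factors localizing at `X` at step `k`. -/
def termLabels (k : ℕ) (X : C.Dom) (n : ℕ) : Finset (Fin (n + 1) → PolyLabel C.Dom Bnd) :=
  (Fintype.piFinset fun _ => polyLabels G D k X).filter fun t => Covers G X fun i => (t i).Z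

/-- [folklore] Membership in the term catalogue IS localization: for every `(k, X, n)` only FINITELY many labels with `n + 1`
factors localize at `X`. -/
theorem mem_termLabels {k : ℕ} {X : C.Dom} {n : ℕ} {t : Fin (n + 1) → PolyLabel C.Dom Bnd} :
    t ∈ termLabels G D k X n ↔ TermIdx.LocalizesAt G D k X ⟨n, t⟩ := by
  simp only [termLabels, Finset.mem_filter, Fintype.mem_piFinset, mem_polyLabels, TermIdx.LocalizesAt]
  exact Iff.rfl

omit [DecidableEq Bnd] in
/-- [folklore] The polymer tuple of a localizing label is in the tuple catalogue. -/
theorem polys_mem_polyTuples {k : ℕ} {X : C.Dom} {t : TermIdx C.Dom Bnd} (ht : t.LocalizesAt G D k X) :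
    t.polys ∈ polyTuples G k X t.1 :=
  (mem_polyTuples G).2 ⟨fun i => ⟨(ht.1 i).1, (ht.1 i).2.1⟩, ht.2⟩

end Catalogues

/-! ## §3 The Ursell coefficient `ρᵀ` of (2.12) and the coefficient `ρᵀ/(n+1)!` of a term -/

section Ursell

variable {C : Carriers} [DecidableEq C.Dom] {Cube : Type*} [DecidableEq Cube] (G : DomainGeometry C Cube)

/-- [folklore] The relation `ζ(Zᵢ, Zⱼ) = 0` on the INDICES of a tuple: the footprints of `Zᵢ` and `Zⱼ` touch ((2.11) p. 14:
*"ζ(Z, Z′) = 0 if Z ∩ Z′ contains a cube, or a wall of a cube"* — the geometry's `touch`). -/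
def touchRel {n : ℕ} (Z : Fin (n + 1) → C.Dom) : Fin (n + 1) → Fin (n + 1) → Prop :=
  fun i j => G.touch (G.cubes (Z i)) (G.cubes (Z j))

/-- [folklore] The touching relation on indices is decidable. -/
instance decTouchRel {n : ℕ} (Z : Fin (n + 1) → C.Dom) : DecidableRel (touchRel G Z) :=
  fun _ _ => G.decTouch _ _

/-- [folklore] The touching relation on indices is symmetric. -/
theorem touchRel_symm {n : ℕ} (Z : Fin (n + 1) → C.Dom) : ∀ i j, touchRel G Z i j → touchRel G Z j i :=
  fun _ _ h => G.touch_symm _ _ h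

/-- [folklore] **`ρᵀ(Z₁,…,Zₙ)`** of (2.12) p. 14 for the touching relation of the geometry — AS the tree's Möbius-defined hard-core
Ursell coefficient of the full index set (`Literature.Probability.LatticeModels.hcUrsell`; equal to the printed connected-graph sum
by `rhoT_eq_sum_graphs`). -/
def rhoT {n : ℕ} (Z : Fin (n + 1) → C.Dom) : ℤ := hcUrsell (touchRel G Z) Finset.univ

/-- [folklore] *"ρᵀ(Z) = 1"* ((2.12)): a single polymer has coefficient `1`. -/
theorem rhoT_one (Z : Fin 1 → C.Dom) : rhoT G Z = 1 := by
  rw [rhoT, show (Finset.univ : Finset (Fin 1)) = {0} from Finset.univ_unique, hcUrsell_singleton]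

open Classical in
/-- [folklore] **(2.12) AS PRINTED**: `ρᵀ(Z₁,…,Zₙ) = Σ_{g ∈ Cₙ} Π_{{i,j}∈g} (ζ(Zᵢ,Zⱼ) − 1)`, the sum over all connected graphs on
the index set with the hard-core weights `ζ − 1 ∈ {0, −1}` (the tree's reproduction `hcUrsell_eq_sum_graphs` of the published
formula, Dimock RMP 25 (2013) App. B, applied to the touching relation). -/
theorem rhoT_eq_sum_graphs {n : ℕ} (Z : Fin (n + 1) → C.Dom) :
    rhoT G Z = ∑ g ∈ (pairs (Finset.univ : Finset (Fin (n + 1)))).powerset with IsConnColl (Adj g) Finset.univ,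
      ∏ e ∈ g, zetaSubOne (touchRel G Z) Finset.univ e :=
  hcUrsell_eq_sum_graphs (touchRel_symm G Z) Finset.univ_nonempty

/-- [folklore] `ρᵀ` is SYMMETRIC: relabelling the tuple by a permutation does not change it. -/
theorem rhoT_perm {n : ℕ} (Z : Fin (n + 1) → C.Dom) (σ : Equiv.Perm (Fin (n + 1))) : rhoT G (Z ∘ σ) = rhoT G Z := by
  have h := hcUrsell_map σ.toEmbedding (H := touchRel G (Z ∘ σ)) (H' := touchRel G Z) (fun a b => Iff.rfl) Finset.univ
  rw [Finset.map_univ_equiv] at h; exact h.symm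

/-- [folklore] The COEFFICIENT `ρᵀ(Z₁,…,Zₙ)/n!` of (2.13) carried by a term label (here `n + 1` factors). -/
noncomputable def coeff {Bnd : Type*} (t : TermIdx C.Dom Bnd) : ℝ := (rhoT G t.polys : ℝ) / (t.1 + 1).factorial

/-- [folklore] A one-factor label has coefficient `1`. -/
theorem coeff_one {Bnd : Type*} (p : Fin 1 → PolyLabel C.Dom Bnd) : coeff G (⟨0, p⟩ : TermIdx C.Dom Bnd) = 1 := by
  simp [coeff, rhoT_one]

end Ursell

/-! ## §4 Bookkeeping: the flat term family versus (2.13)∘(2.9), and `HasSum` by levels -/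

section Bookkeeping

variable {C : Carriers} [DecidableEq C.Dom] {Cube : Type*} [DecidableEq Cube] {Bnd : Type*} [DecidableEq Bnd]
  (G : DomainGeometry C Cube) (D : InnerData C Bnd)

/-- [folklore] **PRODUCT OF SUMS ↔ SUM OVER TERM LABELS** (the level-`n` slice of (2.13)∘(2.9)): for any values `φ` of the factor
terms and any tuple coefficient `c`, summing `c(Z(t))·Π_i φ(t i)` over the term labels with `n + 1` factors localizing at `X` equals
summing `c(Z)·Π_i H(Z i)` over the covering polymer tuples, where `H(Z) := Σ_{ℓ ∈ innerLabels k Z} φ⟨Z, ℓ⟩` is the activity as the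
sum of its terms. -/
theorem sum_termLabels_eq_sum_polyTuples (k : ℕ) (X : C.Dom) (n : ℕ) (c : (Fin (n + 1) → C.Dom) → ℂ)
    (φ : PolyLabel C.Dom Bnd → ℂ) :
    ∑ t ∈ termLabels G D k X n, c (fun i => (t i).Z) * ∏ i, φ (t i) =
      ∑ Z ∈ polyTuples G k X n, c Z * ∏ i, ∑ ℓ ∈ innerLabels D k (Z i), φ ⟨Z i, ℓ⟩ := by
  classical
  have hexp : ∀ Z : Fin (n + 1) → C.Dom, c Z * ∏ i, ∑ ℓ ∈ innerLabels D k (Z i), φ ⟨Z i, ℓ⟩ =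
      ∑ L ∈ Fintype.piFinset (fun i => innerLabels D k (Z i)), c Z * ∏ i, φ ⟨Z i, L i⟩ := by
    intro Z
    rw [Finset.prod_univ_sum, Finset.mul_sum]
  simp_rw [hexp]
  rw [Finset.sum_sigma']
  refine Finset.sum_nbij' (fun t => ⟨fun i => (t i).Z, fun i => (t i).inner⟩) (fun p i => ⟨p.1 i, p.2 i⟩) ?_ ?_
    (fun _ _ => rfl) (fun _ _ => rfl) (fun _ _ => rfl)
  · intro t ht
    have ht' := (mem_termLabels G D).1 ht
    refine Finset.mem_sigma.2 ⟨polys_mem_polyTuples G D ht', ?_⟩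
    exact Fintype.mem_piFinset.2 fun i => (mem_innerLabels D).2 (ht'.1 i).2.2
  · intro p hp
    obtain ⟨hZ, hL⟩ := Finset.mem_sigma.1 hp
    obtain ⟨hZi, hcov⟩ := (mem_polyTuples G).1 hZ
    refine (mem_termLabels G D).2 ⟨fun i => ⟨(hZi i).1, (hZi i).2, ?_⟩, hcov⟩
    exact (mem_innerLabels D).1 (Fintype.mem_piFinset.1 hL i)

/-- [folklore] **`HasSum` BY LEVELS.**  A family on the term index supported on the labels localizing at `X` whose level sums of
norms `Σ_{t ∈ termLabels k X n} ‖f ⟨n, t⟩‖` form a summable sequence in `n` HAS the sum `Σ' n, Σ_{t ∈ termLabels k X n} f ⟨n, t⟩`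
(absolute convergence on the sigma type; the form in which the convergence estimates (2.38)–(2.41) are printed: a bound per `n`,
then the sum over `n`). -/
theorem hasSum_of_levelwise (k : ℕ) (X : C.Dom) {f : TermIdx C.Dom Bnd → ℂ}
    (hsupp : ∀ t, ¬ t.LocalizesAt G D k X → f t = 0)
    (hsum : Summable fun n => ∑ t ∈ termLabels G D k X n, ‖f ⟨n, t⟩‖) :
    HasSum f (∑' n, ∑ t ∈ termLabels G D k X n, f ⟨n, t⟩) := by
  have hfin (n) (t : Fin (n + 1) → PolyLabel C.Dom Bnd) (ht : t ∉ termLabels G D k X n) : f ⟨n, t⟩ = 0 :=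
    hsupp ⟨n, t⟩ fun h => ht ((mem_termLabels G D).2 h)
  have hlevel : ∀ n, Summable fun t : Fin (n + 1) → PolyLabel C.Dom Bnd => ‖f ⟨n, t⟩‖ :=
    fun n => summable_of_ne_finset_zero (s := termLabels G D k X n) fun t ht => by rw [hfin n t ht, norm_zero]
  have htsum : ∀ n, ∑' t : Fin (n + 1) → PolyLabel C.Dom Bnd, ‖f ⟨n, t⟩‖ = ∑ t ∈ termLabels G D k X n, ‖f ⟨n, t⟩‖ :=
    fun n => tsum_eq_sum fun t ht => by rw [hfin n t ht, norm_zero]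
  have hnorm : Summable fun t : TermIdx C.Dom Bnd => ‖f t‖ := by
    refine (summable_sigma_of_nonneg fun _ => norm_nonneg _).2 ⟨hlevel, ?_⟩
    simpa only [htsum] using hsum
  have hf : Summable f := hnorm.of_norm
  have hlevel' : ∀ n, Summable fun t : Fin (n + 1) → PolyLabel C.Dom Bnd => f ⟨n, t⟩ :=
    fun n => summable_of_ne_finset_zero (s := termLabels G D k X n) (hfin n)
  have heq : ∑' t, f t = ∑' n, ∑ t ∈ termLabels G D k X n, f ⟨n, t⟩ := by
    rw [hf.tsum_sigma' hlevel']
    exact tsum_congr fun n => tsum_eq_sum (hfin n)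
  exact heq ▸ hf.hasSum

end Bookkeeping

/-! ## §5 DESIGN FINDING and its tool: anchored CODINGS of the labels (re-indexing is lossless for `TermRep`) -/

section Coding

variable {C : Carriers} [DecidableEq C.Dom] {Cube : Type*} [DecidableEq Cube] {Bnd : Type*}
  (G : DomainGeometry C Cube) (D : InnerData C Bnd)

/-- [folklore] An ANCHORED CODING of the term labels: for every `(k, X)` an injection `code k X` of the labels localizing at `X`
into a common code type `ι₀`.  WHY (design finding of this row): the weights `a k i` of `T4InputCauchyRateTermwise.TermBound`∕
`TermBudget` do not see `X`, so with absolute labels the budget `Σ_i a k i ≤ G` is extensive in the number of domains of the step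
volume; labels coded relative to `X` (translation-covariantly on the torus — O1-a's geometry supplies it) make a code determine a
SHAPE, hence a volume-uniform majorant, and (2.41) p. 21 per `X` plus a (1.26)-type sum over shapes give a volume-uniform `G`. -/
structure Coding (ι₀ : Type*) where
  code : ℕ → C.Dom → TermIdx C.Dom Bnd → ι₀
  inj : ∀ k X (t t' : TermIdx C.Dom Bnd), t.LocalizesAt G D k X → t'.LocalizesAt G D k X →
    code k X t = code k X t' → t = t'

/-- [folklore] The ABSOLUTE coding (codes = labels): the trivial, extensive instance (non-vacuity of `Coding`). -/
def Coding.absolute : Coding G D (TermIdx C.Dom Bnd) := ⟨fun _ _ t => t, fun _ _ _ _ _ _ h => h⟩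

namespace Coding

variable {G D} {ι₀ : Type*} (κ : Coding G D ι₀) {Op Hist : Type*}

open Classical in
/-- [folklore] RE-INDEXING a term family along a coding: the coded family at code `i` is the term of the (unique) label
localizing at `X` with that code, and `0` if there is none. -/
noncomputable def lift (T : ℕ → TermIdx C.Dom Bnd → Op → Hist → C.Dom → ℂ) : ℕ → ι₀ → Op → Hist → C.Dom → ℂ :=
  fun k i o h X =>
    if hx : ∃ t : TermIdx C.Dom Bnd, t.LocalizesAt G D k X ∧ κ.code k X t = i then T k (Classical.choose hx) o h X else 0

/-- [folklore] The lift read at the code of a localizing label is the original term. -/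
theorem lift_code (T : ℕ → TermIdx C.Dom Bnd → Op → Hist → C.Dom → ℂ) {k : ℕ} {X : C.Dom} {t : TermIdx C.Dom Bnd}
    (ht : t.LocalizesAt G D k X) (o : Op) (h : Hist) : κ.lift T k (κ.code k X t) o h X = T k t o h X := by
  classical
  have hx : ∃ t' : TermIdx C.Dom Bnd, t'.LocalizesAt G D k X ∧ κ.code k X t' = κ.code k X t := ⟨t, ht, rfl⟩
  unfold lift
  rw [dif_pos hx, κ.inj k X _ _ (Classical.choose_spec hx).1 ht (Classical.choose_spec hx).2]

/-- [folklore] The lift vanishes off the codes of the localizing labels. -/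
theorem lift_eq_zero (T : ℕ → TermIdx C.Dom Bnd → Op → Hist → C.Dom → ℂ) {k : ℕ} {X : C.Dom} {i : ι₀}
    (hi : ∀ t : TermIdx C.Dom Bnd, t.LocalizesAt G D k X → κ.code k X t ≠ i) (o : Op) (h : Hist) :
    κ.lift T k i o h X = 0 := by
  classical
  unfold lift
  exact dif_neg fun ⟨t, ht, hc⟩ => hi t ht hc

/-- [folklore] **RE-INDEXING IS LOSSLESS**: for a term family vanishing off the labels localizing at `X`, the coded family has a
sum `s` iff the original family does. -/
theorem hasSum_lift_iff (T : ℕ → TermIdx C.Dom Bnd → Op → Hist → C.Dom → ℂ) {k : ℕ} {X : C.Dom} (o : Op) (h : Hist)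
    (hsupp : ∀ t : TermIdx C.Dom Bnd, ¬ t.LocalizesAt G D k X → T k t o h X = 0) (s : ℂ) :
    HasSum (fun i => κ.lift T k i o h X) s ↔ HasSum (fun t => T k t o h X) s := by
  classical
  let S : Set (TermIdx C.Dom Bnd) := {t | t.LocalizesAt G D k X}
  let e : S → ι₀ := fun t => κ.code k X t.1
  have he : Function.Injective e := fun t t' htt' => Subtype.ext (κ.inj k X _ _ t.2 t'.2 htt')
  have hoff : ∀ i, i ∉ Set.range e → κ.lift T k i o h X = 0 :=
    fun i hi => κ.lift_eq_zero T (fun t ht hc => hi ⟨⟨t, ht⟩, hc⟩) o h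
  have hcomp : (fun i => κ.lift T k i o h X) ∘ e = (fun t => T k t o h X) ∘ ((↑) : S → TermIdx C.Dom Bnd) :=
    funext fun t => κ.lift_code T t.2 o h
  have hS : Function.support (fun t => T k t o h X) ⊆ S := fun t ht => by_contra fun hn => ht (hsupp t hn)
  rw [← he.hasSum_iff hoff, hcomp]
  exact hasSum_subtype_iff_of_support_subset hS

variable [NormedAddCommGroup Op] [NormedSpace ℂ Op] [NormedAddCommGroup Hist] [NormedSpace ℂ Hist]

/-- [folklore] **`TermRep` TRANSFERS ALONG A CODING**: if the absolute term family represents the model's output on the class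
(`T4InputCauchyRateTermwise.TermRep`, BY NAME) and vanishes off the localizing labels, so does the coded family.  (d2∕d3 may thus
work with absolute labels; the anchored coding is applied at the end.) -/
theorem termRep_lift (M : StepModel C Op Hist) (K : ℕ → (ℕ → ℝ) → C.BgB → Set (Op × Hist))
    (T : ℕ → TermIdx C.Dom Bnd → Op → Hist → C.Dom → ℂ) {W : Set (ℕ → ℝ)}
    (hsupp : ∀ k (X : C.Dom) (o : Op) (h : Hist) (t : TermIdx C.Dom Bnd), ¬ t.LocalizesAt G D k X → T k t o h X = 0)
    (hrep : TermRep M K T W) : TermRep M K (κ.lift T) W := by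
  intro k g hg U q hq X hX
  exact (κ.hasSum_lift_iff T q.1 q.2 (hsupp k X q.1 q.2) _).2 (hrep k g hg U q hq X hX)

end Coding

end Coding

end Summit.QuantumFields.BalabanUV.T4Continuum.B13StepTermLabels
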